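import Mathlib

/-!
# Route OverlapGapAlgebra, crux `SearchHardWindow` (stmt-PneNP-2460): one-step positivity of the
# `ε`-resampling kernel

On the finite product space `ι → Γ` (uniform `Γ`) the `ε`-resampling ("noise") kernel
`P_ε(y, y') = ∏_i ((1 − ε)·[y i = y' i] + ε/|Γ|)` is positive semidefinite for `0 ≤ ε ≤ 1`, in the
counting form consumed by the grand-correlation inequality of line `Sketch`:
`(Σ_y f y)² ≤ #(ι → Γ) · Σ_{y,y'} P_ε(y, y') f y f y'` (`stub_resamplePositivity`; O'Donnell 2014,
§8.3–8.4: the noise operator `T_ρ`, `ρ = 1 − ε ∈ [0, 1]`, is a positive operator since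
`T_ρ = T_{√ρ} T_{√ρ}` with `T_{√ρ}` self-adjoint; Huang–Sellke 2025 §3.3, proof of Lemma 3.15:
"`y, y'` are conditionally i.i.d. given the shared coordinates, then Jensen").

Proof (semigroup / "half-step" form of the conditional-independence argument). Take the
resampling parameter `δ ∈ [0, 1]` with `1 − δ = √(1 − ε)`, so `(1 − δ)² = 1 − ε`. One coordinate of
the kernel is the Gram matrix of the half-step kernel: `Σ_c P_δ(a, c) P_δ(b, c) = P_ε(a, b)`
(`rsp_coord_gram`), hence by `Fintype.prod_sum` the product kernel is
`P_ε(y, y') = Σ_z P_δ(y, z) P_δ(y', z)` (`rsp_kernel_gram`). The half-step kernel is stochastic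
(`rsp_kernel_sum_eq_one`), so `Σ_{y,y'} P_ε f f' = Σ_z (Σ_y P_δ(y, z) f y)²` and
`Σ_z Σ_y P_δ(y, z) f y = Σ_y f y`, and Cauchy–Schwarz over the `#(ι → Γ)` values of `z`
(`sq_sum_le_card_mul_sum_sq`) gives the claim (`rsp_sq_sum_le_of_gram`). The two one-coordinate
facts `rsp_coord_sum_eq_one`, `rsp_kernel_sum_eq_one` are re-proved here (three lines each) to keep
the file independent of `…ResampleKernelBasic`.

References: R. O'Donnell, *Analysis of Boolean Functions*, CUP 2014, §8.3–8.4 [ODonnell2014];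
B. Huang, M. Sellke, *Strong low degree hardness for stable local optima in spin glasses*,
arXiv:2501.06427 (2025), §3.3 [HuangSellke2025].
-/

set_option linter.dupNamespace false -- `Summit.PneNP.PneNP.…`: summit = sub-problem

namespace Summit.PneNP.PneNP.Theorems

open Finset

/-- One coordinate of the `δ`-resampling kernel is a probability vector:
`Σ_{c : Γ} ((1 − δ)·[a = c] + δ/|Γ|) = 1`. -/
theorem rsp_coord_sum_eq_one {Γ : Type*} [Fintype Γ] [DecidableEq Γ] [Nonempty Γ] (δ : ℝ)
    (a : Γ) : ∑ c : Γ, ((1 - δ) * (if a = c then (1 : ℝ) else 0) + δ / Fintype.card Γ) = 1 := by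
  have hcard : (Fintype.card Γ : ℝ) ≠ 0 := by exact_mod_cast Fintype.card_ne_zero
  rw [Finset.sum_add_distrib, ← Finset.mul_sum, Finset.sum_ite_eq, if_pos (Finset.mem_univ a),
    Finset.sum_const, Finset.card_univ, nsmul_eq_mul, mul_div_cancel₀ _ hcard]
  ring

/-- The `δ`-resampling kernel on `ι → Γ` is stochastic:
`Σ_z ∏_i ((1 − δ)·[y i = z i] + δ/|Γ|) = ∏_i 1 = 1` (`Fintype.prod_sum` read backwards). -/
theorem rsp_kernel_sum_eq_one {ι Γ : Type*} [Fintype ι] [DecidableEq ι] [Fintype Γ]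
    [DecidableEq Γ] [Nonempty Γ] (δ : ℝ) (y : ι → Γ) :
    ∑ z : ι → Γ, ∏ i, ((1 - δ) * (if y i = z i then (1 : ℝ) else 0) + δ / Fintype.card Γ) = 1 := by
  rw [← Fintype.prod_sum fun i (c : Γ) =>
    (1 - δ) * (if y i = c then (1 : ℝ) else 0) + δ / Fintype.card Γ]
  exact Finset.prod_eq_one fun i _ => rsp_coord_sum_eq_one δ (y i)

/-- **Half-step (semigroup) identity in one coordinate**: if `(1 − δ)² = 1 − ε` then
`Σ_c ((1 − δ)[a = c] + δ/|Γ|)·((1 − δ)[b = c] + δ/|Γ|) = (1 − ε)[a = b] + ε/|Γ|`, i.e. the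
one-coordinate `ε`-resampling kernel is the Gram matrix of the `δ`-resampling kernel
(`T_{√ρ} ∘ T_{√ρ} = T_ρ`, O'Donnell 2014 §8.3). -/
theorem rsp_coord_gram {Γ : Type*} [Fintype Γ] [DecidableEq Γ] [Nonempty Γ] (ε δ : ℝ)
    (h : (1 - δ) ^ 2 = 1 - ε) (a b : Γ) :
    ∑ c : Γ, ((1 - δ) * (if a = c then (1 : ℝ) else 0) + δ / Fintype.card Γ) *
        ((1 - δ) * (if b = c then (1 : ℝ) else 0) + δ / Fintype.card Γ) =
      (1 - ε) * (if a = b then (1 : ℝ) else 0) + ε / Fintype.card Γ := by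
  have hrow : ∑ c : Γ, ((1 - δ) * (if a = c then (1 : ℝ) else 0) + δ / Fintype.card Γ) = 1 :=
    rsp_coord_sum_eq_one δ a
  have hpick : ∑ c : Γ, (if b = c then (1 : ℝ) else 0) *
      ((1 - δ) * (if a = c then (1 : ℝ) else 0) + δ / Fintype.card Γ) =
      (1 - δ) * (if a = b then (1 : ℝ) else 0) + δ / Fintype.card Γ := by
    simp_rw [boole_mul]
    rw [Finset.sum_ite_eq, if_pos (Finset.mem_univ b)]
  have hε : ε = 1 - (1 - δ) ^ 2 := by linarith
  calc ∑ c : Γ, ((1 - δ) * (if a = c then (1 : ℝ) else 0) + δ / Fintype.card Γ) *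
        ((1 - δ) * (if b = c then (1 : ℝ) else 0) + δ / Fintype.card Γ)
      = ∑ c : Γ, ((1 - δ) * ((if b = c then (1 : ℝ) else 0) *
          ((1 - δ) * (if a = c then (1 : ℝ) else 0) + δ / Fintype.card Γ)) +
          δ / Fintype.card Γ *
            ((1 - δ) * (if a = c then (1 : ℝ) else 0) + δ / Fintype.card Γ)) :=
        Finset.sum_congr rfl fun c _ => by ring
    _ = (1 - δ) * ∑ c : Γ, (if b = c then (1 : ℝ) else 0) *
          ((1 - δ) * (if a = c then (1 : ℝ) else 0) + δ / Fintype.card Γ) +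
          δ / Fintype.card Γ *
            ∑ c : Γ, ((1 - δ) * (if a = c then (1 : ℝ) else 0) + δ / Fintype.card Γ) := by
        rw [Finset.sum_add_distrib, ← Finset.mul_sum, ← Finset.mul_sum]
    _ = (1 - δ) * ((1 - δ) * (if a = b then (1 : ℝ) else 0) + δ / Fintype.card Γ) +
          δ / Fintype.card Γ * 1 := by rw [hpick, hrow]
    _ = (1 - ε) * (if a = b then (1 : ℝ) else 0) + ε / Fintype.card Γ := by
        rw [hε]; ring

/-- **Gram form of the product kernel**: if `(1 − δ)² = 1 − ε` then
`P_ε(y, y') = Σ_{z : ι → Γ} P_δ(y, z) · P_δ(y', z)` — the `ε`-resampling kernel on `ι → Γ` is one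
`δ`-resampling half-step followed by a reversed one (coordinatewise `rsp_coord_gram`, then
`Fintype.prod_sum`). -/
theorem rsp_kernel_gram {ι Γ : Type*} [Fintype ι] [DecidableEq ι] [Fintype Γ] [DecidableEq Γ]
    [Nonempty Γ] (ε δ : ℝ) (h : (1 - δ) ^ 2 = 1 - ε) (y y' : ι → Γ) :
    (∏ i, ((1 - ε) * (if y i = y' i then (1 : ℝ) else 0) + ε / Fintype.card Γ)) =
      ∑ z : ι → Γ,
        (∏ i, ((1 - δ) * (if y i = z i then (1 : ℝ) else 0) + δ / Fintype.card Γ)) *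
          ∏ i, ((1 - δ) * (if y' i = z i then (1 : ℝ) else 0) + δ / Fintype.card Γ) := by
  simp_rw [← Finset.prod_mul_distrib]
  rw [← Fintype.prod_sum fun i (c : Γ) =>
    ((1 - δ) * (if y i = c then (1 : ℝ) else 0) + δ / Fintype.card Γ) *
      ((1 - δ) * (if y' i = c then (1 : ℝ) else 0) + δ / Fintype.card Γ)]
  exact Finset.prod_congr rfl fun i _ => (rsp_coord_gram ε δ h (y i) (y' i)).symm

/-- **Positivity of a Gram kernel with a stochastic factor** (abstract Cauchy–Schwarz step): if
`P y y' = Σ_z G y z · G y' z` and every row of `G` sums to `1`, then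
`(Σ_y f y)² ≤ #β · Σ_{y,y'} P y y' · f y · f y'`. Indeed `Σ_{y,y'} P f f' = Σ_z (Σ_y G y z f y)²`
and `Σ_z Σ_y G y z f y = Σ_y f y`. -/
theorem rsp_sq_sum_le_of_gram {α β : Type*} [Fintype α] [Fintype β] (P : α → α → ℝ)
    (G : α → β → ℝ) (f : α → ℝ) (hP : ∀ y y', P y y' = ∑ z, G y z * G y' z)
    (hG : ∀ y, ∑ z, G y z = 1) :
    (∑ y, f y) ^ 2 ≤ Fintype.card β * ∑ y, ∑ y', P y y' * (f y * f y') := by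
  have hL : ∑ z, ∑ y, G y z * f y = ∑ y, f y := by
    rw [Finset.sum_comm]
    refine Finset.sum_congr rfl fun y _ => ?_
    rw [← Finset.sum_mul, hG y, one_mul]
  have hR : ∑ y, ∑ y', P y y' * (f y * f y') = ∑ z, (∑ y, G y z * f y) ^ 2 := by
    calc ∑ y, ∑ y', P y y' * (f y * f y')
        = ∑ y, ∑ y', ∑ z, (G y z * f y) * (G y' z * f y') := by
          refine Finset.sum_congr rfl fun y _ => Finset.sum_congr rfl fun y' _ => ?_
          rw [hP, Finset.sum_mul]
          exact Finset.sum_congr rfl fun z _ => by ring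
      _ = ∑ y, ∑ z, ∑ y', (G y z * f y) * (G y' z * f y') :=
          Finset.sum_congr rfl fun y _ => Finset.sum_comm
      _ = ∑ z, ∑ y, ∑ y', (G y z * f y) * (G y' z * f y') := Finset.sum_comm
      _ = ∑ z, (∑ y, G y z * f y) ^ 2 := by
          refine Finset.sum_congr rfl fun z _ => ?_
          rw [sq, Finset.sum_mul_sum]
  calc (∑ y, f y) ^ 2 = (∑ z, ∑ y, G y z * f y) ^ 2 := by rw [hL]
    _ ≤ #(univ : Finset β) * ∑ z, (∑ y, G y z * f y) ^ 2 := sq_sum_le_card_mul_sum_sq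
    _ = Fintype.card β * ∑ y, ∑ y', P y y' * (f y * f y') := by rw [Finset.card_univ, hR]

/-- **One-step positivity of the `ε`-resampling kernel** (O'Donnell 2014 §8.3–8.4; Huang–Sellke
2025 §3.3, proof of Lemma 3.15): for `0 ≤ ε ≤ 1` and every `f : (ι → Γ) → ℝ`,
`(Σ_y f y)² ≤ #(ι → Γ) · Σ_{y,y'} P_ε(y, y') · f y · f y'` with
`P_ε(y, y') = ∏_i ((1 − ε)·[y i = y' i] + ε/|Γ|)`. Proof: `P_ε = P_δ P_δᵀ` for the half-step
resampling parameter `δ ∈ [0, 1]`, `1 − δ = √(1 − ε)` (`rsp_kernel_gram`), `P_δ` is stochastic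
(`rsp_kernel_sum_eq_one`), and Cauchy–Schwarz (`rsp_sq_sum_le_of_gram`). -/
theorem stub_resamplePositivity {ι Γ : Type*} [Fintype ι] [DecidableEq ι] [Fintype Γ]
    [DecidableEq Γ] [Nonempty Γ] (ε : ℝ) (hε0 : 0 ≤ ε) (hε1 : ε ≤ 1) (f : (ι → Γ) → ℝ) :
    (∑ y, f y) ^ 2 ≤ Fintype.card (ι → Γ) *
      ∑ y : ι → Γ, ∑ y' : ι → Γ,
        (∏ i, ((1 - ε) * (if y i = y' i then (1 : ℝ) else 0) + ε / Fintype.card Γ)) *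
          (f y * f y') := by
  -- the half-step resampling parameter `δ = 1 − √(1 − ε) ∈ [0, 1]`, `(1 − δ)² = 1 − ε`
  -- (only the last property is consumed below: positivity needs `ε ≤ 1` alone)
  obtain ⟨δ, -, -, hsq⟩ : ∃ δ : ℝ, 0 ≤ δ ∧ δ ≤ 1 ∧ (1 - δ) ^ 2 = 1 - ε := by
    refine ⟨1 - Real.sqrt (1 - ε), ?_, ?_, ?_⟩
    · exact sub_nonneg.mpr (Real.sqrt_le_one.mpr (by linarith))
    · linarith [Real.sqrt_nonneg (1 - ε)]
    · rw [sub_sub_cancel, Real.sq_sqrt (sub_nonneg.mpr hε1)]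
  exact rsp_sq_sum_le_of_gram
    (fun y y' : ι → Γ => ∏ i, ((1 - ε) * (if y i = y' i then (1 : ℝ) else 0) + ε / Fintype.card Γ))
    (fun y z : ι → Γ => ∏ i, ((1 - δ) * (if y i = z i then (1 : ℝ) else 0) + δ / Fintype.card Γ))
    f (fun y y' => rsp_kernel_gram ε δ hsq y y') (fun y => rsp_kernel_sum_eq_one δ y)

end Summit.PneNP.PneNP.Theorems
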